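import Literature.NumberTheory.LFunctions.GaussianThetaOddKernelIntegral
import Literature.NumberTheory.LFunctions.GaussianThetaLValueOne
import Literature.NumberTheory.EllipticCurves.GaussianLatticeZetaRows
import HarnessLib

/-!
# The value at `s = 1` of a weight-one theta `L`-series of `ℤ[i]` as a finite sum of
# Eisenstein–Kronecker numbers (Birch–Swinnerton-Dyer 1965, (3.5))

Topic `Literature/NumberTheory/LFunctions`, completing `GaussianThetaSeries` /
`GaussianThetaLValueOne` (the entire continuation `thetaLFunction M ψ` of
`Σ_{x ∈ ℤ[i]} ψ(x) x N(x)^{-s}` and `L_ψ(1) = (π/M) ∫₀^∞ θ_ψ`) with the companions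
`GaussianThetaOddKernelIntegral` (`∫₀^∞ oddKernel(a,u) e^{−πy²u} du = Re cot π(a + iy)`) and
`GaussianLatticeZetaRows` (`Re ζ(z)/π − Re z = Σ_m Re cot π(z − mi)` for the Weierstrass zeta
function `ζ` of `Λ = ℤi + ℤ`). Everything here is proved; there are no new definitions.

**Main result** (`thetaLFunction_one_eq_sum_kroneckerE₁`). For `M ≥ 1` and any coefficient
`ψ : ℤ[i] → ℂ`,

  `L_ψ(1) = thetaLFunction M ψ 1 = (1/M) Σ_{c mod M} ψ(c) · conj E₁*(c/M)`,

where `E₁*(z) = ζ_Λ(z) − π z̄` is the Eisenstein–Kronecker function of `ℤi + ℤ`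
(`Literature.NumberTheory.EllipticCurves.GaussianLattice.kroneckerE₁`,
`GaussianLatticeQuarterValues`),
`c` runs over `ℤ[i]/M` with the representatives `c₁ + c₂ i`, `0 ≤ c₁, c₂ < M` of
`GaussianThetaSeries`, and `E₁*(0) = 0`. This is exactly (3.5) of Birch–Swinnerton-Dyer,
*Notes on elliptic curves. II* (Crelle 218 (1965), p. 85):
"`L_D(1) = (1/KΔ) Σ (D/ρ)₄ ξ(ρ/KΔ) − (π/N(KΔ)) Σ ρ̄ (D/ρ)₄`" — there for the character
`σ ↦ (D/σ)₄ σ̄` of `y² = x³ − Dx`, here for an arbitrary periodic coefficient (the tree's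
`L(E_n, s) = ¼ Σ ψ_n(x) x N(x)^{-s}`, `CongruentNumberCurveHeckeSeries`, has `x` in place of
BSD's `σ̄`, whence the complex conjugate). BSD obtain it from the `s`-deformation (3.4) of the
zeta series and `(s − 1)ζ_{ℚ(i)}(s) → π/4`; here it comes from the theta integral:

* `integral_oddKernel_mul_evenKernel` —
  **`∫₀^∞ oddKernel(a,u) evenKernel(b,u) du = Re ζ(a+bi)/π − a`**
  for `a + bi ∉ Λ` (sum `∫ oddKernel(a,u) e^{−π(m+b)²u} du = Re cot π(a + (m+b)i)` over `m`,
  dominated convergence, then the row formula for `ζ`);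
* `integral_classTheta` — **`∫₀^∞ Θ_c(t) dt = conj E₁*(c/M)/π`** for the class theta functions
  `Θ_c = M(oddKernel·evenKernel + i evenKernel·oddKernel)(Mt)` (the second integral is the first
  at the point `b + ai = i · conj(a + bi)`, and `ζ(iz) = −iζ(z)`, `ζ(z̄) = conj ζ(z)`);
* `thetaLFunction_one_eq_sum_kroneckerE₁` — summing over the classes.

## References

* B. J. Birch, H. P. F. Swinnerton-Dyer, *Notes on elliptic curves. II*, J. reine angew. Math.
  218 (1965) 79–108, §3, (3.2)–(3.5), p. 84–85 (GDZ `PPN243919689_0218`).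
* A. Weil, *Elliptic functions according to Eisenstein and Kronecker* (1976), Ch. VIII
  (`E₁*` and Kronecker's limit formula in weight one).
-/

noncomputable section

open Complex Real Set Filter Topology Asymptotics MeasureTheory HurwitzZeta

open Literature.NumberTheory.EllipticCurves Literature.NumberTheory.EllipticCurves.GaussianLattice

namespace Literature.NumberTheory.LFunctions

namespace GaussianTheta

/-! ### `ζ(z̄) = conj ζ(z)` and `ζ(0) = 0` for `ℤi + ℤ` -/

/-- `ζ_{conj Λ}(conj z) = conj ζ_Λ(z)` for every period pair. [folklore] -/
theorem weierstrassZeta_conjugate_conj (L : PeriodPair) (z : ℂ) :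
    L.conjugate.weierstrassZeta ((starRingEnd ℂ) z) = (starRingEnd ℂ) (L.weierstrassZeta z) := by
  simp only [PeriodPair.weierstrassZeta, Complex.conj_tsum]
  rw [← L.latticeConjEquiv.tsum_eq]
  congr with l
  simp [map_sub, map_inv₀, map_pow, map_div₀]

/-- **`ζ(z̄) = conj ζ(z)`** for the (real) lattice `ℤi + ℤ`. [folklore] -/
theorem weierstrassZeta_conj (z : ℂ) :
    (PeriodPair.ofUpperHalfPlane UpperHalfPlane.I).weierstrassZeta ((starRingEnd ℂ) z) =
      (starRingEnd ℂ) ((PeriodPair.ofUpperHalfPlane UpperHalfPlane.I).weierstrassZeta z) := by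
  rw [← weierstrassZeta_conjugate_conj,
    GaussianLattice.weierstrassZeta_eq_of_lattice_eq GaussianLattice.isReal.conjugate_lattice_eq]

/-- `ζ_Λ(0) = 0` (every term `1/(0 − w) + 1/w + 0` of the series vanishes; at `w = 0` by the junk
convention). [folklore] -/
theorem weierstrassZeta_zero (L : PeriodPair) : L.weierstrassZeta 0 = 0 := by
  simp only [PeriodPair.weierstrassZeta, zero_sub, zero_div, add_zero, one_div, inv_neg,
    neg_add_cancel, tsum_zero]

/-- `E₁*(0) = 0`. [folklore] -/
theorem kroneckerE₁_zero : kroneckerE₁ 0 = 0 := by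
  rw [kroneckerE₁_def, weierstrassZeta_zero, map_zero, mul_zero, sub_zero]

/-! ### `∫₀^∞ oddKernel(a,u) evenKernel(b,u) du = Re ζ(a + bi)/π − a` -/

/-- If `a + bi ∉ ℤi + ℤ` then `a + (m + b)i ∉ ℤ` for every `m ∈ ℤ`: either `m + b ≠ 0` or
`a ∉ ℤ`. [folklore] -/
theorem ne_zero_or_mem_integerComplement {a b : ℝ}
    (h : (a : ℂ) + b * I ∉ (PeriodPair.ofUpperHalfPlane UpperHalfPlane.I).lattice) (m : ℤ) :
    (m : ℝ) + b ≠ 0 ∨ (a : ℂ) ∈ Complex.integerComplement := by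
  by_contra hc
  simp only [not_or, not_not] at hc
  obtain ⟨hmb, ha⟩ := hc
  rw [Complex.mem_integerComplement_iff, not_not] at ha
  obtain ⟨k, hk⟩ := ha
  apply h
  rw [GaussianLattice.mem_lattice_iff]
  refine ⟨-m, k, ?_⟩
  have hb : (b : ℂ) = -(m : ℂ) := by
    have : b = -(m : ℝ) := by linarith
    rw [this]; push_cast; ring
  rw [hk, hb]
  push_cast
  ring

/-- **`∫₀^∞ oddKernel(a,u) · evenKernel(b,u) du = Re ζ(a + bi)/π − a`** for real `a, b` with
`a + bi ∉ Λ = ℤi + ℤ`: expanding `evenKernel(b,u) = Σ_m e^{−π(m+b)²u}` and integrating termwise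
(dominated convergence, the partial sums being dominated by `|oddKernel(a,u)| evenKernel(b,u)`),
each term is `Re cot π(a + (m+b)i)` (`integral_oddKernel_mul_exp_eq_re_cot`), and the sum over
`m` is `Re ζ(a+bi)/π − a` (`GaussianLattice.hasSum_re_cot_coord`). [folklore] -/
theorem integral_oddKernel_mul_evenKernel {a b : ℝ}
    (h : (a : ℂ) + b * I ∉ (PeriodPair.ofUpperHalfPlane UpperHalfPlane.I).lattice) :
    ∫ u in Ioi (0 : ℝ), oddKernel a u * evenKernel b u =
      ((PeriodPair.ofUpperHalfPlane UpperHalfPlane.I).weierstrassZeta (a + b * I)).re / π - a := by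
  set F : ℤ → ℝ → ℝ := fun m u ↦ oddKernel a u * rexp (-(π * ((m : ℝ) + b) ^ 2) * u) with hF
  -- termwise integration
  have hmeas : ∀ m, AEStronglyMeasurable (F m) (volume.restrict (Ioi 0)) := fun m ↦
    ((continuousOn_oddKernel _).mul (by fun_prop)).aestronglyMeasurable measurableSet_Ioi
  have hbound : ∀ m, ∀ᵐ u ∂(volume.restrict (Ioi 0)), ‖F m u‖ ≤
      ‖oddKernel (a : UnitAddCircle) u‖ * rexp (-(π * ((m : ℝ) + b) ^ 2) * u) := by
    intro m
    filter_upwards with u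
    simp only [F, norm_mul, Real.norm_of_nonneg (Real.exp_pos _).le, le_refl]
  have hsum : ∀ᵐ u ∂(volume.restrict (Ioi 0)), Summable fun m : ℤ ↦
      ‖oddKernel (a : UnitAddCircle) u‖ * rexp (-(π * ((m : ℝ) + b) ^ 2) * u) := by
    filter_upwards [ae_restrict_mem measurableSet_Ioi] with u hu
    have hs := (hasSum_int_evenKernel b hu).summable.mul_left (‖oddKernel (a : UnitAddCircle) u‖)
    refine hs.congr fun m ↦ ?_
    show ‖oddKernel (a : UnitAddCircle) u‖ * rexp (-π * ((m : ℝ) + b) ^ 2 * u) =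
      ‖oddKernel (a : UnitAddCircle) u‖ * rexp (-(π * ((m : ℝ) + b) ^ 2) * u)
    ring_nf
  have htsum : ∀ u ∈ Ioi (0 : ℝ), ∑' m : ℤ, ‖oddKernel (a : UnitAddCircle) u‖ *
      rexp (-(π * ((m : ℝ) + b) ^ 2) * u) = ‖oddKernel (a : UnitAddCircle) u‖ * evenKernel b u := by
    intro u hu
    rw [tsum_mul_left]
    congr 1
    rw [← (hasSum_int_evenKernel b hu).tsum_eq]
    refine tsum_congr fun m ↦ ?_
    ring_nf
  have hint : Integrable (fun u ↦ ∑' m : ℤ, ‖oddKernel (a : UnitAddCircle) u‖ *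
      rexp (-(π * ((m : ℝ) + b) ^ 2) * u)) (volume.restrict (Ioi 0)) :=
    (integrableOn_norm_oddKernel_mul_evenKernel a b).congr_fun (fun u hu ↦ (htsum u hu).symm)
      measurableSet_Ioi
  have hlim : ∀ᵐ u ∂(volume.restrict (Ioi 0)), HasSum (fun m ↦ F m u)
      (oddKernel a u * evenKernel b u) := by
    filter_upwards [ae_restrict_mem measurableSet_Ioi] with u hu
    refine ((hasSum_int_evenKernel b hu).mul_left (oddKernel (a : UnitAddCircle) u)).congr_fun
      fun m ↦ ?_
    simp only [F]
    congr 1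
    ring_nf
  have hmain := hasSum_integral_of_dominated_convergence
    (fun (m : ℤ) (u : ℝ) ↦ ‖oddKernel (a : UnitAddCircle) u‖ * rexp (-(π * ((m : ℝ) + b) ^ 2) * u))
    hmeas hbound hsum hint hlim
  -- the terms
  have hterm : ∀ m : ℤ, ∫ u in Ioi (0 : ℝ), F m u =
      (Complex.cot (π * (a + ((m : ℝ) + b : ℝ) * I))).re := fun m ↦
    integral_oddKernel_mul_exp_eq_re_cot a ((m : ℝ) + b) (ne_zero_or_mem_integerComplement h m)
  simp_rw [hterm] at hmain
  -- the lattice side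
  have hlat := GaussianLattice.hasSum_re_cot_coord h
  have hlat' : HasSum (fun m : ℤ ↦ (Complex.cot (π * (a + ((m : ℝ) + b : ℝ) * I))).re)
      (((PeriodPair.ofUpperHalfPlane UpperHalfPlane.I).weierstrassZeta (a + b * I)).re / π - a) :=
      by
    refine hlat.congr_fun fun m ↦ ?_
    push_cast
    ring_nf
  exact hmain.unique hlat'

/-! ### The integral of a class theta function -/

variable (M : ℕ) [NeZero M]

/-- The point `c/M = (c₁ + c₂ i)/M` of a nonzero class `c` (representatives `0 ≤ c₁, c₂ < M`) is not
a lattice point. [folklore] -/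
theorem classPoint_notMem_lattice {c : ZMod M × ZMod M} (hc : c ≠ 0) :
    (((c.1.val : ℝ) / M : ℝ) : ℂ) + (((c.2.val : ℝ) / M : ℝ) : ℂ) * I ∉
      (PeriodPair.ofUpperHalfPlane UpperHalfPlane.I).lattice := by
  have hM : (0 : ℝ) < M := by exact_mod_cast Nat.pos_of_ne_zero (NeZero.ne M)
  intro hmem
  rw [GaussianLattice.mem_lattice_iff] at hmem
  obtain ⟨m, n, hmn⟩ := hmem
  have hre := congrArg Complex.re hmn
  have him := congrArg Complex.im hmn
  simp only [Complex.add_re, Complex.mul_re, Complex.intCast_re, Complex.I_re, mul_zero,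
    Complex.intCast_im, Complex.I_im, mul_one, sub_self, zero_add, Complex.ofReal_re,
    Complex.ofReal_im, Complex.add_im, Complex.mul_im, add_zero] at hre him
  -- `n = c₁/M`, `m = c₂/M` with `0 ≤ cᵢ < M` force `c₁ = c₂ = 0`
  have h1 : (c.1.val : ℝ) = n * M := by field_simp at hre; linarith
  have h2 : (c.2.val : ℝ) = m * M := by field_simp at him; linarith
  have hc1 : c.1.val < M := ZMod.val_lt c.1
  have hc2 : c.2.val < M := ZMod.val_lt c.2
  have hn0 : (0 : ℝ) ≤ n := by
    have : (0 : ℝ) ≤ c.1.val := Nat.cast_nonneg _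
    nlinarith
  have hm0 : (0 : ℝ) ≤ m := by
    have : (0 : ℝ) ≤ c.2.val := Nat.cast_nonneg _
    nlinarith
  have hn1 : (n : ℝ) < 1 := by
    have : (c.1.val : ℝ) < M := by exact_mod_cast hc1
    nlinarith
  have hm1 : (m : ℝ) < 1 := by
    have : (c.2.val : ℝ) < M := by exact_mod_cast hc2
    nlinarith
  have hn : n = 0 := by
    have h0 : (0 : ℤ) ≤ n := by exact_mod_cast hn0
    have h1' : n < 1 := by exact_mod_cast hn1
    omega
  have hm : m = 0 := by
    have h0 : (0 : ℤ) ≤ m := by exact_mod_cast hm0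
    have h1' : m < 1 := by exact_mod_cast hm1
    omega
  subst hn; subst hm
  simp only [Int.cast_zero, zero_mul] at h1 h2
  have e1 : c.1.val = 0 := by exact_mod_cast h1
  have e2 : c.2.val = 0 := by exact_mod_cast h2
  apply hc
  ext
  · simpa [ZMod.val_eq_zero] using e1
  · simpa [ZMod.val_eq_zero] using e2

/-- The second integral of a class: `∫₀^∞ evenKernel(a,u) oddKernel(b,u) du = −Im ζ(a+bi)/π − b`
for `a + bi ∉ Λ` (the first formula at `b + ai = i · conj(a + bi)`, with `ζ(iz) = −iζ(z)`,
`ζ(z̄) = conj ζ(z)`). [folklore] -/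
theorem integral_evenKernel_mul_oddKernel {a b : ℝ}
    (h : (a : ℂ) + b * I ∉ (PeriodPair.ofUpperHalfPlane UpperHalfPlane.I).lattice) :
    ∫ u in Ioi (0 : ℝ), evenKernel a u * oddKernel b u =
      -((PeriodPair.ofUpperHalfPlane UpperHalfPlane.I).weierstrassZeta (a + b * I)).im / π - b := by
  have hpt : (b : ℂ) + a * I = I * (starRingEnd ℂ) ((a : ℂ) + b * I) := by
    simp only [map_add, Complex.conj_ofReal, map_mul, Complex.conj_I]
    linear_combination (b : ℂ) * I_sq
  have h' : (b : ℂ) + a * I ∉ (PeriodPair.ofUpperHalfPlane UpperHalfPlane.I).lattice := by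
    intro hmem
    apply h
    rw [GaussianLattice.mem_lattice_iff] at hmem ⊢
    obtain ⟨m, n, hmn⟩ := hmem
    refine ⟨n, m, ?_⟩
    have hre := congrArg Complex.re hmn
    have him := congrArg Complex.im hmn
    simp only [Complex.add_re, Complex.mul_re, Complex.intCast_re, Complex.I_re, mul_zero,
      Complex.intCast_im, Complex.I_im, mul_one, sub_self, zero_add, Complex.ofReal_re,
      Complex.ofReal_im, Complex.add_im, Complex.mul_im, add_zero] at hre him
    apply Complex.ext <;> simp [hre, him]
  have h1 := integral_oddKernel_mul_evenKernel h'
  rw [show (fun u ↦ evenKernel (a : UnitAddCircle) u * oddKernel (b : UnitAddCircle) u) =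
      fun u ↦ oddKernel (b : UnitAddCircle) u * evenKernel (a : UnitAddCircle) u from
    funext fun u ↦ mul_comm _ _, h1, hpt, GaussianLattice.weierstrassZeta_I_mul,
    weierstrassZeta_conj]
  simp only [neg_mul, Complex.neg_re, Complex.mul_re, Complex.I_re, Complex.conj_re, zero_mul,
    Complex.I_im, Complex.conj_im, one_mul, zero_sub, neg_neg]

/-- Each class theta function is integrable on `(0, ∞)`. [folklore] -/
theorem integrableOn_classTheta (c : ZMod M × ZMod M) : IntegrableOn (classTheta M c) (Ioi 0) := by
  have h : MellinConvergent (classTheta M c) 1 :=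
    mellinConvergent_of_isBigO_rpow (a := 2) (b := 0)
      ((continuousOn_classTheta M c).locallyIntegrableOn measurableSet_Ioi)
      (isBigO_atTop_classTheta M c 2) (by simp only [Complex.one_re]; norm_num)
      (isBigO_nhdsGT_classTheta M c 0) (by simp only [Complex.one_re]; norm_num)
  refine IntegrableOn.congr_fun h (fun t _ ↦ ?_) measurableSet_Ioi
  simp only [sub_self, Complex.cpow_zero, one_smul]

/-- **`∫₀^∞ Θ_c(t) dt = conj E₁*(c/M) / π`** for every class `c` modulo `M ℤ[i]` (for `c = 0`
both sides vanish). With `a = c₁/M`, `b = c₂/M`: the substitution `u = Mt` gives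
`∫ oddKernel(a)evenKernel(b) + i ∫ evenKernel(a)oddKernel(b) = (Re ζ/π − a) + i(−Im ζ/π − b)
= conj(ζ(a+bi) − π(a − bi))/π`. [cite: BirchSwinnertonDyer1965NotesII, §3 (3.5)] -/
theorem integral_classTheta (c : ZMod M × ZMod M) :
    ∫ t in Ioi (0 : ℝ), classTheta M c t =
      (starRingEnd ℂ) (kroneckerE₁ ((((c.1.val : ℝ) / M : ℝ) : ℂ) +
        (((c.2.val : ℝ) / M : ℝ) : ℂ) * I)) / π := by
  have hM : (0 : ℝ) < M := by exact_mod_cast Nat.pos_of_ne_zero (NeZero.ne M)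
  have hMc : (M : ℂ) ≠ 0 := Nat.cast_ne_zero.mpr (NeZero.ne M)
  set a : ℝ := (c.1.val : ℝ) / M with ha
  set b : ℝ := (c.2.val : ℝ) / M with hb
  rcases eq_or_ne c 0 with rfl | hc
  · -- the zero class: `Θ_0 ≡ 0` and `E₁*(0) = 0`
    have h0 : a = 0 := by simp [ha]
    have h0' : b = 0 := by simp [hb]
    have hz : ((a : ℂ) + (b : ℂ) * I) = 0 := by rw [h0, h0']; simp
    rw [hz, kroneckerE₁_zero, map_zero, zero_div]
    refine (setIntegral_congr_fun measurableSet_Ioi (g := fun _ ↦ (0 : ℂ)) fun t _ ↦ ?_).trans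
      (by simp)
    simp only [classTheta]
    rw [show (((0 : ZMod M × ZMod M).1.val : ℝ) / M : ℝ) = 0 by simp,
      show (((0 : ZMod M × ZMod M).2.val : ℝ) / M : ℝ) = 0 by simp]
    simp
  -- nonzero class
  have hnot : (a : ℂ) + (b : ℂ) * I ∉ (PeriodPair.ofUpperHalfPlane UpperHalfPlane.I).lattice :=
    classPoint_notMem_lattice M hc
  set G : ℝ → ℂ := fun u ↦ (M : ℂ) * (((oddKernel a u * evenKernel b u : ℝ) : ℂ) +
    I * ((evenKernel a u * oddKernel b u : ℝ) : ℂ)) with hG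
  have hcomp : ∀ t : ℝ, classTheta M c t = G (M * t) := fun t ↦ by
    simp only [classTheta, G, ha, hb]
    push_cast
    ring
  have h1 : ∫ t in Ioi (0 : ℝ), classTheta M c t = (M : ℝ)⁻¹ • ∫ u in Ioi (0 : ℝ), G u := by
    simp_rw [hcomp]
    have := integral_comp_mul_left_Ioi G 0 hM
    rwa [mul_zero] at this
  have hIA := integrableOn_oddKernel_mul_evenKernel (a : UnitAddCircle) (b : UnitAddCircle)
  have hIB : IntegrableOn
      (fun u : ℝ ↦ evenKernel (a : UnitAddCircle) u * oddKernel (b : UnitAddCircle) u)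
      (Ioi 0) := by
    refine (integrableOn_oddKernel_mul_evenKernel (b : UnitAddCircle) (a : UnitAddCircle)).congr_fun
      (fun u _ ↦ mul_comm _ _) measurableSet_Ioi
  have hIAc : IntegrableOn (fun u : ℝ ↦ ((oddKernel a u * evenKernel b u : ℝ) : ℂ)) (Ioi 0) :=
    hIA.ofReal
  have hIBc : IntegrableOn (fun u : ℝ ↦ I * ((evenKernel a u * oddKernel b u : ℝ) : ℂ)) (Ioi 0) :=
    hIB.ofReal.const_mul I
  have hintA : ∫ u in Ioi (0 : ℝ), ((oddKernel a u * evenKernel b u : ℝ) : ℂ) =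
      ((∫ u in Ioi (0 : ℝ), oddKernel a u * evenKernel b u : ℝ) : ℂ) := integral_ofReal
  have hintB : ∫ u in Ioi (0 : ℝ), ((evenKernel a u * oddKernel b u : ℝ) : ℂ) =
      ((∫ u in Ioi (0 : ℝ), evenKernel a u * oddKernel b u : ℝ) : ℂ) := integral_ofReal
  have h2 : ∫ u in Ioi (0 : ℝ), G u = (M : ℂ) *
      (((∫ u in Ioi (0 : ℝ), oddKernel a u * evenKernel b u : ℝ) : ℂ) +
        I * ((∫ u in Ioi (0 : ℝ), evenKernel a u * oddKernel b u : ℝ) : ℂ)) := by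
    simp only [G]
    rw [integral_const_mul, integral_add hIAc hIBc, integral_const_mul, hintA, hintB]
  rw [h1, h2, integral_oddKernel_mul_evenKernel hnot, integral_evenKernel_mul_oddKernel hnot,
    kroneckerE₁_def]
  -- algebra: `conj(ζ − π(a − bi))/π = (Re ζ/π − a) + i(−Im ζ/π − b)`
  set w := (PeriodPair.ofUpperHalfPlane UpperHalfPlane.I).weierstrassZeta ((a : ℂ) + (b : ℂ) * I)
  have hw : (starRingEnd ℂ) w = (w.re : ℂ) - (w.im : ℂ) * I := by
    apply Complex.ext <;> simp
  have hπ : (π : ℂ) ≠ 0 := Complex.ofReal_ne_zero.mpr Real.pi_ne_zero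
  simp only [map_sub, map_mul, Complex.conj_ofReal, Complex.conj_conj, hw, Complex.real_smul]
  push_cast
  field_simp
  ring

/-! ### The value at `s = 1` -/

variable (ψ : GaussianInt → ℂ)

/-- `∫₀^∞ θ_ψ = Σ_c ψ(c) ∫₀^∞ Θ_c`. [folklore] -/
theorem integral_theta_eq_sum :
    ∫ t in Ioi (0 : ℝ), theta M ψ t =
      ∑ c : ZMod M × ZMod M, ψ (rep M c 0) * ∫ t in Ioi (0 : ℝ), classTheta M c t := by
  simp only [theta]
  rw [integral_finsetSum _ fun c _ ↦ (integrableOn_classTheta M c).const_mul _]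
  refine Finset.sum_congr rfl fun c _ ↦ ?_
  exact integral_const_mul _ _

/-- **Birch–Swinnerton-Dyer (3.5) for a weight-one theta series of `ℤ[i]`: the value at `s = 1`.**
For `M ≥ 1` and any coefficient `ψ : ℤ[i] → ℂ`,
`thetaLFunction M ψ 1 = (1/M) Σ_{c mod M} ψ(c) · conj E₁*((c₁ + c₂ i)/M)`, the sum over the
classes `c` modulo `M ℤ[i]` with representatives `0 ≤ c₁, c₂ < M`, `E₁*(z) = ζ_{ℤi+ℤ}(z) − π z̄`
(`GaussianLattice.kroneckerE₁`; `E₁*(0) = 0`). For `ψ` periodic modulo `M` the left side is the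
value at `1` of the entire continuation of `Σ_x ψ(x) x N(x)^{-s}` (`thetaLFunction_eq_LSeries`).
[cite: BirchSwinnertonDyer1965NotesII, §3 (3.5) p. 85] -/
theorem thetaLFunction_one_eq_sum_kroneckerE₁ :
    thetaLFunction M ψ 1 = 1 / (M : ℂ) * ∑ c : ZMod M × ZMod M,
      ψ (rep M c 0) * (starRingEnd ℂ) (kroneckerE₁ ((((c.1.val : ℝ) / M : ℝ) : ℂ) +
        (((c.2.val : ℝ) / M : ℝ) : ℂ) * I)) := by
  have hMc : (M : ℂ) ≠ 0 := Nat.cast_ne_zero.mpr (NeZero.ne M)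
  have hπ : (π : ℂ) ≠ 0 := Complex.ofReal_ne_zero.mpr Real.pi_ne_zero
  rw [thetaLFunction_one, integral_theta_eq_sum, Finset.mul_sum, Finset.mul_sum]
  refine Finset.sum_congr rfl fun c _ ↦ ?_
  rw [integral_classTheta]
  field_simp

end GaussianTheta

end Literature.NumberTheory.LFunctions

end
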